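import Mathlib
import HarnessLib
import Summits.Langlands.Langlands.Theses.SkinnerWilesDefectOne
import Summits.Langlands.Langlands.Theorems.SkinnerWilesDefectOneReducibleOrdinaryProModularDefs
import Literature.NumberTheory.GaloisRepresentations.AbsolutelyIrreducibleReduction
import Literature.NumberTheory.GaloisRepresentations.PadicIntermediateFieldIntegers
import Literature.NumberTheory.GaloisRepresentations.PotentialDiagonalizabilityCriteriaProofs
import Literature.NumberTheory.GaloisRepresentations.NearlyOrdinaryDeformationRingProofs
import Summits.Langlands.Langlands.Theorems.SkinnerWilesDefectOneReducibleOrdinaryProModularOrientedSteinbergDatumRibetAux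

/-! # The Skinner–Wiles oriented end lattice of `ρ` over a finite `E/ℚ_p`: helper file
`…OrientedSteinbergDatumEndLatticeAux` for stub `stub_orientedSteinbergDatum` of line steinberg-hyperplane
(crux ReducibleOrdinaryProModular, stmt-Langlands-12919)

From the crux data — `ρ : Γ_F → GL₂(ℚ̄_p)` continuous irreducible with an integral model `ρ₀` over the valuation
ring `O` of `ℚ̄_p` that is upper triangular modulo `𝔪_O`, `p`-distinguished and SW-oriented ordinary at every
`v ∣ p` (`OrdLoc`) — this file produces (`endLattice_exists`, REGISTERED helper statement) a finite extension
`E/ℚ_p` inside `ℚ̄_p` and a change of frame `T = (1 s; 0 ϖⁿ) ∈ GL₂(ℚ̄_p)` such that `ρ' = T ρ T⁻¹` has all its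
entries in the valuation ring of `E`, is upper triangular modulo the maximal ideal with the SAME ordered residual
diagonal as `ρ₀`, has NON-SPLIT reduction (Ribet's end lattice, `ribet_selection` + `endLattice_nonsplit`), is
residually `p`-distinguished, and at every `v ∣ p` carries an integral ORIENTED ordinary vector `(x_v, 1)`
(common eigenvector of `ρ'|_{D_v}`; `endLattice_eigenline`).  Ingredients: all entries of `ρ` lie in a finite
`E/ℚ_p` (`FramedGaloisRep.exists_finiteDimensional_forall_mem`, Baire); irreducibility forbids a stable line;
the oriented frame `Q` of `OrdLoc` (`‖Q₀₀‖ ≤ ‖Q₁₀‖`) gives the integral eigenvector `(Q₀₀/Q₁₀, 1)` whose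
eigencharacter is residually the LOWER diagonal character — the lattice-free content of the orientation.

References: Skinner–Wiles, Publ. Math. IHÉS 89 (1999), §2.1, §4.6; Ribet, Invent. Math. 34 (1976), Prop. 2.1.
-/

set_option linter.dupNamespace false
set_option autoImplicit false

namespace Summit.Langlands.Langlands.Cruxes.ReducibleOrdinaryProModular.SteinbergHyperplane

open scoped NumberField MatrixGroups
open Filter NumberField IsDedekindDomain Field Polynomial Matrix IsLocalRing
open Literature.NumberTheory.Automorphic Literature.NumberTheory.Automorphic.BigHeckeGLn
open Literature.NumberTheory.GaloisRepresentations
open Summit.Langlands.Langlands.Theses.SkinnerWilesDefectOne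

noncomputable section

namespace OrientedDatum

variable {p : ℕ} [Fact p.Prime]

/-! ### Irreducibility forbids a stable line -/

/-- An irreducible `ρ : Γ_F → GL₂(ℚ̄_p)` has no stable line `⟨e₁ - s e₀⟩`: in entries,
`b + s (d - a) - s² c` cannot vanish identically. [folklore] -/
theorem not_forall_stableLine {F : Type} [Field F] (ρ : FramedGaloisRep F (PadicAlgCl p) 2)
    (hirr : ρ.toGaloisRep.IsIrreducible) (s : PadicAlgCl p)
    (h : ∀ g, (ρ g).val 0 1 + s * ((ρ g).val 1 1 - (ρ g).val 0 0) - s ^ 2 * (ρ g).val 1 0 = 0) :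
    False := by
  have hso : IsSimpleOrder (Subrepresentation (FramedRep.toRepresentation ρ)) := hirr
  set w : Fin 2 → PadicAlgCl p := ![-s, 1] with hw
  have hstab : ∀ g, (ρ g).val *ᵥ w = ((ρ g).val 1 1 - (ρ g).val 1 0 * s) • w := by
    intro g
    ext i
    fin_cases i
    · simp [hw, Matrix.mulVec, dotProduct, Fin.sum_univ_two]
      linear_combination h g
    · simp [hw, Matrix.mulVec, dotProduct, Fin.sum_univ_two]
      ring
  let W : Subrepresentation (FramedRep.toRepresentation ρ) :=
    ⟨Submodule.span (PadicAlgCl p) {w}, fun g v hv => by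
      obtain ⟨c, rfl⟩ := Submodule.mem_span_singleton.1 hv
      rw [map_smul, FramedRep.toRepresentation_apply_apply, hstab g, smul_smul]
      exact Submodule.mem_span_singleton.2 ⟨_, rfl⟩⟩
  rcases hso.eq_bot_or_eq_top W with hbot | htop
  · have h1 : w ∈ (Submodule.span (PadicAlgCl p) {w} : Submodule (PadicAlgCl p) (Fin 2 → PadicAlgCl p)) :=
      Submodule.mem_span_singleton_self w
    have h2 : Submodule.span (PadicAlgCl p) {w} = (⊥ : Submodule (PadicAlgCl p) (Fin 2 → PadicAlgCl p)) :=
      congrArg Subrepresentation.toSubmodule hbot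
    rw [h2, Submodule.mem_bot] at h1
    have : w 1 = 0 := by rw [h1]; rfl
    simp [hw] at this
  · have h2 : Submodule.span (PadicAlgCl p) {w} = (⊤ : Submodule (PadicAlgCl p) (Fin 2 → PadicAlgCl p)) :=
      congrArg Subrepresentation.toSubmodule htop
    have h1 : (![1, 0] : Fin 2 → PadicAlgCl p) ∈ Submodule.span (PadicAlgCl p) {w} := by
      rw [h2]; exact Submodule.mem_top
    obtain ⟨c, hc⟩ := Submodule.mem_span_singleton.1 h1
    have hc1 := congrFun hc 1
    have hc0 := congrFun hc 0
    simp [hw] at hc1 hc0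
    rw [hc1] at hc0
    simp at hc0

/-! ### The oriented frame gives an integral eigenvector -/

/-- From `M Q = Q N` with `N` upper triangular (`N₁₀ = 0`) and `Q₁₀ ≠ 0`: the vector `(Q₀₀/Q₁₀, 1)` is an
eigenvector of `M` with eigenvalue `M₁₀ (Q₀₀/Q₁₀) + M₁₁`. [folklore] -/
theorem eigen_of_frame {K : Type*} [Field K] (M Q N : Matrix (Fin 2) (Fin 2) K) (hMQ : M * Q = Q * N)
    (hN : N 1 0 = 0) (hQ : Q 1 0 ≠ 0) :
    M 0 0 * (Q 0 0 / Q 1 0) + M 0 1 = (M 1 0 * (Q 0 0 / Q 1 0) + M 1 1) * (Q 0 0 / Q 1 0) := by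
  have e0 := congrFun (congrFun hMQ 0) 0
  have e1 := congrFun (congrFun hMQ 1) 0
  simp only [Matrix.mul_apply, Fin.sum_univ_two, hN, mul_zero, add_zero] at e0 e1
  field_simp
  linear_combination Q 1 0 * e0 - Q 0 0 * e1

/-- The places of `F` above `p` form a finite type. [folklore] -/
theorem finite_placesAbove (F : Type) [Field F] [NumberField F] :
    Finite {v : HeightOneSpectrum (𝓞 F) // (p : 𝓞 F) ∈ v.asIdeal} := by
  have hp0 : (Ideal.span {(p : 𝓞 F)} : Ideal (𝓞 F)) ≠ 0 := by
    rw [Ne, Ideal.zero_eq_bot, Ideal.span_singleton_eq_bot]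
    exact_mod_cast (Fact.out : p.Prime).ne_zero
  have hfin := Ideal.finite_factors hp0
  refine (hfin.subset fun v hv => ?_).to_subtype
  simp only [Set.mem_setOf_eq] at hv ⊢
  rw [Ideal.dvd_iff_le, Ideal.span_singleton_le_iff_mem]
  exact hv

/-! ### Norm bookkeeping in `O` and in `𝒪_E` -/

/-- `p`-distinguishedness in norm form: some `σ ∈ Γ_{F_v}` has `1 ≤ ‖ρ(σ)₀₀ - ρ(σ)₁₁‖`. [folklore] -/
theorem one_le_norm_sub_of_isPDistinguishedAt {F : Type} [Field F] [NumberField F]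
    {O : ValuationSubring (PadicAlgCl p)} (hO' : ∀ x : PadicAlgCl p, x ∈ O ↔ ‖x‖ ≤ 1)
    {ρ : FramedGaloisRep F (PadicAlgCl p) 2} {ρ₀ : absoluteGaloisGroup F →* GL (Fin 2) O}
    (hmap : ∀ g, Matrix.GeneralLinearGroup.map O.subtype (ρ₀ g) = ρ g) {v : HeightOneSpectrum (𝓞 F)}
    (h : IsPDistinguishedAt ρ₀ v) :
    ∃ σ : absoluteGaloisGroup (v.adicCompletion F),
      1 ≤ ‖(ρ.toLocal v σ).val 0 0 - (ρ.toLocal v σ).val 1 1‖ := by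
  obtain ⟨σ, hσ⟩ := (isPDistinguishedAt_iff ρ₀ v).1 h
  refine ⟨σ, ?_⟩
  rw [mem_maximalIdeal_iff_norm_lt_one hO', not_lt] at hσ
  rw [FramedGaloisRep.toLocal_apply, FramedRep.coe_apply_eq_of_map_eq (hmap _) 0 0,
    FramedRep.coe_apply_eq_of_map_eq (hmap _) 1 1]
  exact hσ

/-- **The oriented end lattice** (all the `ℚ̄_p`-level content of `stub_orientedSteinbergDatum`): a finite
`E/ℚ_p` and `T ∈ GL₂(ℚ̄_p)` with `T ρ T⁻¹` `𝒪_E`-integral, residually upper triangular with the residual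
diagonal of `ρ₀`, residually NON-SPLIT and `p`-distinguished, with an integral oriented ordinary eigenvector
`(x_v, 1)` at every `v ∣ p`. [cite: SkinnerWiles1999, §4.6] -/
theorem endLattice_exists {F : Type} [Field F] [NumberField F] {O : ValuationSubring (PadicAlgCl p)}
    (hO : O = (Valued.v : Valuation (PadicAlgCl p) NNReal).valuationSubring)
    (ρ : FramedGaloisRep F (PadicAlgCl p) 2) (ρ₀ : absoluteGaloisGroup F →* GL (Fin 2) O)
    (hirr : ρ.toGaloisRep.IsIrreducible) (hint : ρ.HasUpperTriangularIntegralModel ρ₀)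
    (hloc : OrdLoc p O ρ ρ₀) :
    ∃ (E : IntermediateField ℚ_[p] (PadicAlgCl p)) (_ : FiniteDimensional ℚ_[p] E)
      (T : GL (Fin 2) (PadicAlgCl p)),
      (∀ g i j, (T * ρ g * T⁻¹).val i j ∈ E ∧ ‖(T * ρ g * T⁻¹).val i j‖ ≤ 1) ∧
      (∀ g, ‖(T * ρ g * T⁻¹).val 1 0‖ < 1) ∧
      (∀ g (i : Fin 2), ‖(T * ρ g * T⁻¹).val i i - (ρ g).val i i‖ < 1) ∧
      (∀ x : PadicAlgCl p, x ∈ E → ‖x‖ ≤ 1 →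
        ∃ g, 1 ≤ ‖(T * ρ g * T⁻¹).val 0 1 - x * ((T * ρ g * T⁻¹).val 1 1 - (T * ρ g * T⁻¹).val 0 0)‖) ∧
      (∃ g, 1 ≤ ‖(ρ g).val 0 0 - (ρ g).val 1 1‖) ∧
      ∀ v : HeightOneSpectrum (𝓞 F), (p : 𝓞 F) ∈ v.asIdeal → ∃ x : PadicAlgCl p, x ∈ E ∧ ‖x‖ ≤ 1 ∧
        (∀ σ, (T * ρ.toLocal v σ * T⁻¹).val 0 0 * x + (T * ρ.toLocal v σ * T⁻¹).val 0 1 =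
          x * ((T * ρ.toLocal v σ * T⁻¹).val 1 0 * x + (T * ρ.toLocal v σ * T⁻¹).val 1 1)) ∧
        ∃ σ, 1 ≤ ‖((T * ρ.toLocal v σ * T⁻¹).val 1 0 * x + (T * ρ.toLocal v σ * T⁻¹).val 1 1) -
          ((T * ρ.toLocal v σ * T⁻¹).val 0 0 - x * (T * ρ.toLocal v σ * T⁻¹).val 1 0)‖ := by
  classical
  have hO' : ∀ x : PadicAlgCl p, x ∈ O ↔ ‖x‖ ≤ 1 := fun x => by
    rw [hO]; exact padicAlgCl_mem_valuationSubring_iff p x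
  obtain ⟨hmap, h10⟩ := (FramedRep.hasUpperTriangularIntegralModel_two_iff _ ρ₀).1 hint
  have hent : ∀ g i j, (ρ g).val i j = (((ρ₀ g).val i j : O) : PadicAlgCl p) := fun g i j =>
    FramedRep.coe_apply_eq_of_map_eq (hmap g) i j
  have hle1 : ∀ g i j, ‖(ρ g).val i j‖ ≤ 1 := fun g i j => by
    rw [hent]; exact (hO' _).1 ((ρ₀ g).val i j).2
  have hc : ∀ g, ‖(ρ g).val 1 0‖ < 1 := fun g => by
    rw [hent]; exact (mem_maximalIdeal_iff_norm_lt_one hO' _).1 (h10 g)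
  obtain ⟨_, _, _, _, hv⟩ := hloc
  -- a finite `E/ℚ_p` containing all entries of `ρ` and of the oriented frames `Q_v`, `v ∣ p`
  obtain ⟨E₁, hE₁, hρE⟩ := FramedGaloisRep.exists_finiteDimensional_forall_mem ρ
  haveI := finite_placesAbove (p := p) F
  let Qv : {v : HeightOneSpectrum (𝓞 F) // (p : 𝓞 F) ∈ v.asIdeal} → GL (Fin 2) (PadicAlgCl p) :=
    fun v => (hv v.1 v.2).2.choose
  have hQv : ∀ v : {v : HeightOneSpectrum (𝓞 F) // (p : 𝓞 F) ∈ v.asIdeal},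
      Valued.v ((Qv v).val 0 0) ≤ Valued.v ((Qv v).val 1 0) ∧
        ∀ σ, ((Qv v)⁻¹ * ρ.toLocal v.1 σ * Qv v).val 1 0 = 0 :=
    fun v => ⟨(hv v.1 v.2).2.choose_spec.1, fun σ => ((hv v.1 v.2).2.choose_spec.2 σ).1⟩
  obtain ⟨E₂, hE₂, hQE⟩ := exists_finiteDimensional_forall_mem_of_finite fun v => (Qv v).val
  haveI := hE₁
  haveI := hE₂
  haveI : FiniteDimensional ℚ_[p] (E₁ ⊔ E₂ : IntermediateField ℚ_[p] (PadicAlgCl p)) :=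
    IntermediateField.finiteDimensional_sup E₁ E₂
  set E : IntermediateField ℚ_[p] (PadicAlgCl p) := E₁ ⊔ E₂ with hEdef
  have h1E : E₁ ≤ E := le_sup_left
  have h2E : E₂ ≤ E := le_sup_right
  -- a uniformizer of `𝒪_E`, seen in `ℚ̄_p`
  set ϖ : PadicAlgCl p :=
    (((intermediateFieldIntegers.uniformizer E : intermediateFieldIntegers p E) : E) : PadicAlgCl p) with hϖdef
  have hϖE : ϖ ∈ E := SetLike.coe_mem _
  have hϖ1 : ‖ϖ‖ < 1 := intermediateFieldIntegers.norm_uniformizer_lt_one E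
  have hϖ0 : ϖ ≠ 0 := by
    intro h
    apply intermediateFieldIntegers.uniformizer_ne_zero E
    have h' : ((intermediateFieldIntegers.uniformizer E : intermediateFieldIntegers p E) : E) = 0 :=
      Subtype.ext h
    exact Subtype.ext h'
  have hdisc : ∀ y : PadicAlgCl p, y ∈ E → ‖y‖ < 1 → ‖y‖ ≤ ‖ϖ‖ := fun y hy hlt =>
    intermediateFieldIntegers.norm_le_norm_uniformizer_of_norm_lt_one E (x := ⟨y, hy⟩) hlt
  have hcpt : IsCompact {s : PadicAlgCl p | s ∈ E ∧ ‖s‖ ≤ 1} := by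
    have hset : {s : PadicAlgCl p | s ∈ E ∧ ‖s‖ ≤ 1} = ((↑) : E → PadicAlgCl p) '' {x : E | ‖x‖ ≤ 1} := by
      ext s
      constructor
      · rintro ⟨hs, hs1⟩; exact ⟨⟨s, hs⟩, hs1, rfl⟩
      · rintro ⟨x, hx, rfl⟩; exact ⟨x.2, hx⟩
    rw [hset]
    exact (intermediateFieldIntegers.isCompact_setOf_norm_le_one E).image continuous_subtype_val
  -- Ribet's selection on the family of all `ρ g`
  obtain ⟨n, s, hsE, hs1, hsf, hmax⟩ := ribet_selection E ϖ hcpt hϖ1 (ι := absoluteGaloisGroup F)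
    (fun g => (ρ g).val 0 0) (fun g => (ρ g).val 0 1) (fun g => (ρ g).val 1 0) (fun g => (ρ g).val 1 1)
    (fun g => hle1 g 0 1) (fun s _ _ h => not_forall_stableLine ρ hirr s h)
  have hϖn1 : ‖ϖ ^ n‖ ≤ 1 := by rw [norm_pow]; exact pow_le_one₀ (norm_nonneg _) hϖ1.le
  -- the conjugator `T = (1 s; 0 ϖⁿ)` and the entries of `T M T⁻¹`
  obtain ⟨T, -, -, hTconj⟩ := exists_conjugator s (ϖ ^ n) (pow_ne_zero _ hϖ0)
  have hT : ∀ M : GL (Fin 2) (PadicAlgCl p),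
      (T * M * T⁻¹).val 0 0 = M.val 0 0 + s * M.val 1 0 ∧
      (T * M * T⁻¹).val 0 1 = (M.val 0 1 + s * (M.val 1 1 - M.val 0 0) - s ^ 2 * M.val 1 0) / ϖ ^ n ∧
      (T * M * T⁻¹).val 1 0 = ϖ ^ n * M.val 1 0 ∧
      (T * M * T⁻¹).val 1 1 = M.val 1 1 - s * M.val 1 0 := by
    intro M
    have h := hTconj M.val
    rw [← Units.val_mul, ← Units.val_mul] at h
    rw [h]
    exact ⟨rfl, rfl, rfl, rfl⟩
  have hnorms : ∀ g, ‖(ρ g).val 0 0 + s * (ρ g).val 1 0‖ ≤ 1 ∧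
      ‖((ρ g).val 0 1 + s * ((ρ g).val 1 1 - (ρ g).val 0 0) - s ^ 2 * (ρ g).val 1 0) / ϖ ^ n‖ ≤ 1 ∧
      ‖ϖ ^ n * (ρ g).val 1 0‖ < 1 ∧ ‖(ρ g).val 1 1 - s * (ρ g).val 1 0‖ ≤ 1 ∧
      ‖((ρ g).val 0 0 + s * (ρ g).val 1 0) - (ρ g).val 0 0‖ < 1 ∧
      ‖((ρ g).val 1 1 - s * (ρ g).val 1 0) - (ρ g).val 1 1‖ < 1 := fun g =>
    endLattice_norms (hle1 g 0 0) (hle1 g 1 1) (hc g) hs1 hϖn1 (by rw [norm_pow]; exact hsf g)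
  refine ⟨E, inferInstance, T, fun g i j => ?_, fun g => ?_, fun g i => ?_, fun x hxE hx1 => ?_, ?_,
    fun v hvp => ?_⟩
  · -- integrality and `E`-rationality of the entries
    obtain ⟨h00, h01, h10', h11⟩ := hT (ρ g)
    have hE' : ∀ i j, (ρ g).val i j ∈ E := fun i j => h1E (hρE g i j).1
    have m00 : (T * ρ g * T⁻¹).val 0 0 ∈ E ∧ ‖(T * ρ g * T⁻¹).val 0 0‖ ≤ 1 := by
      rw [h00]; exact ⟨add_mem (hE' 0 0) (mul_mem hsE (hE' 1 0)), (hnorms g).1⟩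
    have m01 : (T * ρ g * T⁻¹).val 0 1 ∈ E ∧ ‖(T * ρ g * T⁻¹).val 0 1‖ ≤ 1 := by
      rw [h01]
      exact ⟨div_mem (sub_mem (add_mem (hE' 0 1) (mul_mem hsE (sub_mem (hE' 1 1) (hE' 0 0))))
        (mul_mem (pow_mem hsE 2) (hE' 1 0))) (pow_mem hϖE n), (hnorms g).2.1⟩
    have m10 : (T * ρ g * T⁻¹).val 1 0 ∈ E ∧ ‖(T * ρ g * T⁻¹).val 1 0‖ ≤ 1 := by
      rw [h10']; exact ⟨mul_mem (pow_mem hϖE n) (hE' 1 0), (hnorms g).2.2.1.le⟩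
    have m11 : (T * ρ g * T⁻¹).val 1 1 ∈ E ∧ ‖(T * ρ g * T⁻¹).val 1 1‖ ≤ 1 := by
      rw [h11]; exact ⟨sub_mem (hE' 1 1) (mul_mem hsE (hE' 1 0)), (hnorms g).2.2.2.1⟩
    fin_cases i <;> fin_cases j
    exacts [m00, m01, m10, m11]
  · rw [(hT (ρ g)).2.2.1]; exact (hnorms g).2.2.1
  · have d0 : ‖(T * ρ g * T⁻¹).val 0 0 - (ρ g).val 0 0‖ < 1 := by
      rw [(hT (ρ g)).1]; exact (hnorms g).2.2.2.2.1
    have d1 : ‖(T * ρ g * T⁻¹).val 1 1 - (ρ g).val 1 1‖ < 1 := by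
      rw [(hT (ρ g)).2.2.2]; exact (hnorms g).2.2.2.2.2
    fin_cases i
    exacts [d0, d1]
  · -- non-split reduction
    obtain ⟨g, hg⟩ := endLattice_nonsplit E ϖ hϖE hϖ0 hϖ1.le hdisc
      (fun g => (ρ g).val 0 0) (fun g => (ρ g).val 0 1) (fun g => (ρ g).val 1 0) (fun g => (ρ g).val 1 1)
      (fun g => ⟨h1E (hρE g 0 0).1, h1E (hρE g 0 1).1, h1E (hρE g 1 0).1, h1E (hρE g 1 1).1⟩) hc
      n s hsE hs1 hmax x hxE hx1
    refine ⟨g, ?_⟩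
    obtain ⟨h00, h01, -, h11⟩ := hT (ρ g)
    rw [h00, h01, h11]
    exact hg
  · -- residual `p`-distinguishedness somewhere (there is a place above `p`)
    obtain ⟨v₀, hv₀⟩ := NearlyOrdinaryDatum.exists_heightOneSpectrum_mem (F := F) (Fact.out : p.Prime)
    obtain ⟨σ, hσ⟩ := one_le_norm_sub_of_isPDistinguishedAt hO' hmap (hv v₀ hv₀).1
    exact ⟨_, hσ⟩
  · -- the oriented ordinary eigenvector at `v ∣ p`
    set Q := Qv ⟨v, hvp⟩ with hQdef
    obtain ⟨hQor, hQup⟩ := hQv ⟨v, hvp⟩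
    have hQ10 : Q.val 1 0 ≠ 0 := by
      intro h0
      have h00 : Q.val 0 0 = 0 := by
        have := hQor
        rw [← hQdef, h0, map_zero, le_zero_iff] at this
        exact (Valuation.zero_iff _).1 this
      apply Matrix.GeneralLinearGroup.det_ne_zero Q
      rw [Matrix.det_fin_two, h00, h0]; ring
    set u : PadicAlgCl p := Q.val 0 0 / Q.val 1 0 with hudef
    have hu1 : ‖u‖ ≤ 1 := by
      rw [hudef, norm_div]
      refine div_le_one_of_le₀ ?_ (norm_nonneg _)
      have := hQor
      rw [← hQdef, PadicAlgCl.valuation_def, PadicAlgCl.valuation_def] at this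
      exact_mod_cast this
    have huE : u ∈ E := div_mem (h2E (hQE ⟨v, hvp⟩ 0 0)) (h2E (hQE ⟨v, hvp⟩ 1 0))
    have heig : ∀ σ, (ρ.toLocal v σ).val 0 0 * u + (ρ.toLocal v σ).val 0 1 =
        ((ρ.toLocal v σ).val 1 0 * u + (ρ.toLocal v σ).val 1 1) * u := by
      intro σ
      have hMQ : (ρ.toLocal v σ).val * Q.val = Q.val * (Q⁻¹ * ρ.toLocal v σ * Q).val := by
        rw [← Units.val_mul, ← Units.val_mul, mul_assoc, mul_inv_cancel_left]
      have := eigen_of_frame _ _ _ hMQ (by rw [hQdef]; exact hQup σ) hQ10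
      exact this
    obtain ⟨σ₀, hσ₀⟩ := one_le_norm_sub_of_isPDistinguishedAt hO' hmap (hv v hvp).1
    obtain ⟨hx1, hxeig, δ₀, hδ₀⟩ := endLattice_eigenline ϖ hϖ0 hϖ1.le
      (fun σ => (ρ.toLocal v σ).val 0 0) (fun σ => (ρ.toLocal v σ).val 0 1)
      (fun σ => (ρ.toLocal v σ).val 1 0) (fun σ => (ρ.toLocal v σ).val 1 1)
      (fun σ => hc _) n s hs1 (fun σ => hsf _) u hu1 heig ⟨σ₀, hσ₀⟩
    refine ⟨(u + s) / ϖ ^ n, div_mem (add_mem huE hsE) (pow_mem hϖE n), hx1, fun σ => ?_, δ₀, ?_⟩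
    · obtain ⟨h00, h01, h10', h11⟩ := hT (ρ.toLocal v σ)
      rw [h00, h01, h10', h11]
      exact hxeig σ
    · obtain ⟨h00, h01, h10', h11⟩ := hT (ρ.toLocal v δ₀)
      rw [h00, h10', h11]
      exact hδ₀

end OrientedDatum

/-- **Registered sub-goal of `stub_orientedSteinbergDatum` (auxiliary file II): the oriented end lattice**
(= `OrientedDatum.endLattice_exists` with explicit binders). [cite: SkinnerWiles1999, §4.6] -/
theorem stub_orientedSteinbergDatum_auxEndLattice :
    ∀ (F : Type) [Field F] [NumberField F] (p : ℕ) [Fact p.Prime] (O : ValuationSubring (PadicAlgCl p)), O = (Valued.v : Valuation (PadicAlgCl p) NNReal).valuationSubring → ∀ (ρ : FramedGaloisRep F (PadicAlgCl p) 2) (ρ₀ : absoluteGaloisGroup F →* GL (Fin 2) O), ρ.toGaloisRep.IsIrreducible → ρ.HasUpperTriangularIntegralModel ρ₀ → OrdLoc p O ρ ρ₀ → ∃ (E : IntermediateField ℚ_[p] (PadicAlgCl p)) (_ : FiniteDimensional ℚ_[p] E) (T : GL (Fin 2) (PadicAlgCl p)), (∀ g i j, (T * ρ g * T⁻¹).val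 i j ∈ E ∧ ‖(T * ρ g * T⁻¹).val i j‖ ≤ 1) ∧ (∀ g, ‖(T * ρ g * T⁻¹).val 1 0‖ < 1) ∧ (∀ g (i : Fin 2), ‖(T * ρ g * T⁻¹).val i i - (ρ g).val i i‖ < 1) ∧ (∀ x : PadicAlgCl p, x ∈ E → ‖x‖ ≤ 1 → ∃ g, 1 ≤ ‖(T * ρ g * T⁻¹).val 0 1 - x * ((T * ρ g * T⁻¹).val 1 1 - (T * ρ g * T⁻¹).val 0 0)‖) ∧ (∃ g, 1 ≤ ‖(ρ g).val 0 0 - (ρ g).val 1 1‖) ∧ ∀ v : HeightOneSpectrum (𝓞 F), (p : 𝓞 F) ∈ v.asIdeal → ∃ x : PadicAlgCl p, x ∈ E ∧ ‖x‖ ≤ 1 ∧ (∀ σ, (T * ρ.toLocal v σ * T⁻¹).val 0 0 * x + (T * ρ.toLocal v σ * T⁻¹).val 0 1 = x * ((T * ρ.toLocal v σ * T⁻¹).val 1 0 * x + (T * ρ.toLocal v σ * T⁻¹).val 1 1)) ∧ ∃ σ, 1 ≤ ‖((T * ρ.toLocal v σ * T⁻¹).val 1 0 * x + (T * ρ.toLocal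 v σ * T⁻¹).val 1 1) - ((T * ρ.toLocal v σ * T⁻¹).val 0 0 - x * (T * ρ.toLocal v σ * T⁻¹).val 1 0)‖ :=
  fun _ _ _ _ _ _ hO ρ ρ₀ hirr hint hloc => OrientedDatum.endLattice_exists hO ρ ρ₀ hirr hint hloc

end

end Summit.Langlands.Langlands.Cruxes.ReducibleOrdinaryProModular.SteinbergHyperplane
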